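import Summits.QuantumFields.YangMills.Theorems.BalabanUVNodesN07LocalLettersCoreGuarded
import Literature.MathematicalPhysics.QuantumFieldTheory.Balaban1983to89.Node00.CriticalOnFibreTopGuardedB
import HarnessLib

/-!
# BalabanUVNodes ∕ N07 — THE FOUR GUARDED S6 TOKENS OVER A **BOND-LEVEL DETERMINING DATUM**, A **TOP-DATA PREDICATE** AND A **LEVEL-0 EXCLUSION RANGE**:
# `LocalLetters165TopStepCoreGB ∕ LocalLettersSplitTopStepCoreGB ∕ DatumGauge165TopStepCoreGB ∕ DatumGaugeSplitTopStepCoreGB` — row S1c-0 of the (E1)∕(iii-b) work plan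
# (director-ym №338∕№339∕№341; FLAG №16; LOCATE-HSEAM 5d3298b8d191f169), with the same compositions into F0c's `HalvingStepTopCoreGB`

Cell `pub-ymgap`, width seat `pub-ymgap-dag-n07-w3` g15 (CLAIM S1c-0, bus 2026-08-30 07:55:57Z; owner slot dag-n07-e lineage).  `--kind definition --supports stmt-QuantumFields-20541`
(K0⁷; count-neutral).  PURELY ADDITIVE — «print-datum parametrisation of `Summits/…/BalabanUVNodesN07LocalLettersCoreGuarded` (FLAG №16 ∕ LOCATE-HSEAM 5d3298b8d191f169); the
(b)-instances `LocalLetters165TopStepCoreG ∕ LocalLettersSplitTopStepCoreG ∕ DatumGauge165TopStepCoreG ∕ DatumGaugeSplitTopStepCoreG` stay landed and true on their own text»; no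
displayed premise of any token is deleted or weakened — the data row, the two fibre rows and the level-0 plaquette exclusion become PARAMETERS, and dag-n07-w4's tokens are the
instance `(genSetDatum F, dataSmall7PTopOf F N, printedPlaqs0Of F)` by `Iff.rfl`.  [15] = [Balaban1985Variational]; [6] = [Balaban1985RegularSpaces]; [II] = [Balaban1984PropagatorsII];
[III] = [Balaban1988Convergent]; [I] = [Balaban1987RG1].

WHY.  dag-n07-w4's module `…N07LocalLettersCoreGuarded` carries the S6 head's four interface tokens with the guard slot `Adm : StepGuard F` (n07-e's module-47 pattern) and their
compositions into module 47's `HalvingStepTopCoreG`.  Each token displays the data row `Sect2.DataSmall7PTop (avOfRecord F N K) s.Ω (Sup ν K s.Ω) k δ W` and the fibre rows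
`AgreeOn (genSet s.Ω k) (Ū U) W → IsCritOnFibre F N K (genSet s.Ω k) W U` — READING (b) of [III] (2.2)'s determining set — and the two core tokens display the level-0 plaquette
exclusion `p ∉ Sect2.printedPlaqs s.Ω k 0`.  Exactly as F0c (`Node00/CriticalOnFibreTopGuardedB`, ✓p765717) did for module 47, THIS FILE makes those rows parameters
`(bd : BondDatum F) (Dat : TopData F N) (Ex0 : PlaqRange0 F)`, so that the print datum `bd := lamDatum F` ([II] (2.3)'s `Λ_j`, ruling (α)) is an INSTANCE and the chart road's twins
(S1c: `…TowerW152E′`, …) and n07-w2's S1b-2 can compose by name.  Every composition is POINTWISE in `(W, U)` and merely THREADS the rows, so the proofs are dag-n07-w4's terms.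

CONTENTS (this part: §0–§2; PART 2 `…N07LocalLettersCoreGuardedDatumB` holds §3–§5).  §1–§4 the four `…GB` tokens, each with ★ `…G_iff_GB` (`Iff.rfl` at the (b)-instance), `.of_le` (ceilings), `.of_imp` (guard), `.of_imp_dat` (data predicate), the core pair also
`.of_subset_ex0` (exclusion range); ★★ `halvingStepTopCoreGB_of_localLetters165CoreGB ∕ …SplitCoreGB` (same thresholds as the parents), ★★★ `localLetters165CoreGB_of_datumGauge165CoreGB ∕
localLettersSplitCoreGB_of_datumGaugeSplitCoreGB` (the ∃-introduction of the S6 head, at `Ex0 := printedPlaqs0Of F` — the core level is read off print's level-0 exclusion — and, by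
`.of_subset_ex0`, at every larger range), ★★ `halvingStepTopCoreGB_of_datumGauge165CoreGB ∕ …SplitCoreGB`; §5 the four `…R_iff_GB_floorGuard` bridges to dag-n07-w4's floor editions
(definitional).
HONEST FRAMING: definitions of named facts (displayed `Prop`s, NEVER asserted) + binder-threading bookkeeping; NOTHING of Bałaban's analysis proved; no (b)-instance token claimed false
(FLAG №16 concerns which instance print PROVES; the kernel certificate `…N07SeamNotInhabited.not_hseam` concerns the (b)→(2.3) seam, not these tokens); K0⁷ stub 1 NOT closed; N05 ∕ N07
NOT discharged; counts unmoved (typed 28∕28 · discharged 8∕28); R4 = the conditional finite-𝕋⁴ rung `BalabanLadder.UV` ONLY; the YM mass gap (Clay) is NOT proved by any of this; nothing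
continuum ∕ ℝ⁴ ∕ OS.  Two `def`s here (§3–§5 with the other two in PART 2 `…N07LocalLettersCoreGuardedDatumB`), no `instance`, no `notation`, no `sorry`.

References: [15] (7) p.278, (144) p.300, (152) p.301, (159) p.303, (162)–(168) pp.303–304, Prop. 8 p.304; [6] (1.2) p.76, (1.3)–(1.9) p.77, (1.54) p.85; [II] (2.3) p.224;
[III] (2.2) p.255, (2.10)–(2.12) p.256; [I] (0.1) p.251, (1.1) p.260.
-/

noncomputable section

namespace Summit.QuantumFields.YangMills.BalabanUVNodes.N07LocalLettersCoreGuardedB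

open scoped Matrix.Norms.L2Operator
open Literature.MathematicalPhysics.QuantumFieldTheory.Balaban1983to89
open Literature.MathematicalPhysics.QuantumFieldTheory.Balaban1983to89.Node00
open Literature.MathematicalPhysics.QuantumFieldTheory.Balaban1983to89.T4Continuum (T4Family)
open Literature.MathematicalPhysics.QuantumFieldTheory.Balaban1983to89.B15DeterminingSets
open Literature.MathematicalPhysics.QuantumFieldTheory.Balaban1983to89.B15DeterminingSetsB
open B15Eq112TorusCover (cover lift)
open B14DomainGeom (Pt Within cubeIdx)
open B14.Eq213MaximalDomains (side cubeExt)
open B8Eq131Cubes (box)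
open Summit.QuantumFields.YangMills.BalabanUVNodes.N07HalvingStepTopOfLocalLetters (radius_descend threshold167_of_budget165)
open Summit.QuantumFields.YangMills.BalabanUVNodes.N07LocalLettersCoreOfDatumGauges (mem_cubeExt_cubeIdx exists_within_three_of_mem_plaqsOf
  exists_within_three_of_not_mem_bondsDeep_compl)
open Summit.QuantumFields.YangMills.BalabanUVNodes.N07LocalLettersSplitCore (LocalGaugeSplitOn regularTwo_of_localGaugeSplitOn thresholdSplit_plaq thresholdSplit_bond)
open Summit.QuantumFields.YangMills.BalabanUVNodes.N07LocalLettersCoreFloor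
open Summit.QuantumFields.YangMills.BalabanUVNodes.N07LocalLettersCoreGuarded

/-! ## §0  Plumbing (the parents' private steps, restated privately) -/

/-- `0 < η_i ≤ 1`. [cite: Balaban1987RG1, (1.1) p.260 (bookkeeping)] -/
private theorem eta_pos_le_one_b (P : Params) (i : ℕ) : 0 < P.eta i ∧ P.eta i ≤ 1 := by
  have hL : (1 : ℝ) ≤ P.L := by exact_mod_cast P.L_pos
  unfold Params.eta
  exact ⟨pow_pos (inv_pos.mpr (lt_of_lt_of_le one_pos hL)) i, pow_le_one₀ (inv_nonneg.mpr (zero_le_one.trans hL)) (inv_le_one_of_one_le₀ hL)⟩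

/-- The tree's (168) side conditions from `64·t ≤ max{B₃δ, ½ε} ≤ ε ≤ a₀ ≤ ½` at `d = 4`. [cite: Balaban1985Variational, (166)–(168) p.304 (bookkeeping)] -/
private theorem thresholds168_b {d : ℕ} (hd : d = 4) {B₃ δi εi a₀ t : ℝ} (hB₃ : 0 ≤ B₃) (hδi : 0 < δi) (hε : B₃ * δi ≤ εi ∧ εi ≤ a₀)
    (ha₀ : 2 * a₀ ≤ 1) (ht : 64 * t ≤ max (B₃ * δi) (εi / 2)) :
    32 * (d : ℝ) * t ≤ 1 ∧ 32 * t ≤ max (B₃ * δi) (εi / 2) ∧ 2 * t ≤ max (B₃ * δi) (εi / 2) := by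
  have hr0 : 0 ≤ max (B₃ * δi) (εi / 2) := le_max_of_le_left (mul_nonneg hB₃ hδi.le)
  have hε0 : 0 ≤ εi := (mul_nonneg hB₃ hδi.le).trans hε.1
  have hrε : max (B₃ * δi) (εi / 2) ≤ εi := max_le hε.1 (by linarith)
  subst hd
  push_cast
  by_cases h0 : 0 ≤ t
  · exact ⟨by linarith [hε.2], by linarith, by linarith⟩
  · have h0' : t < 0 := lt_of_not_ge h0
    exact ⟨by linarith, by linarith, by linarith⟩

/-! ## §1  The (165)-token over `(bd, Dat, Ex0)` -/

section Token165B

variable (F : T4Family) (N : ℕ) [NeZero N]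

/-- **[15] (165) IN A LOCAL GAUGE AROUND EVERY CORE PLAQUETTE ∕ BOND — GUARDED TOKEN OVER A BOND DATUM, A TOP-DATA PREDICATE AND A LEVEL-0 EXCLUSION RANGE**: dag-n07-w4's
`LocalLetters165TopStepCoreG` with the data row `Dat K s.Ω (Sup ν K s.Ω) k δ W`, the fibre rows `AgreeOnB (bd K k s.Ω) (Ū U) W → IsCritOnFibreB F N K (bd K k s.Ω) W U` and the plaquette
exclusion `p ∉ Ex0 K k s.Ω`; every other byte identical.  Print-datum parametrisation of `LocalLetters165TopStepCoreG` (FLAG №16 ∕ LOCATE-HSEAM 5d3298b8d191f169); the (b)-instance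
stays landed and true on its own text (`localLetters165TopStepCoreG_iff_GB`).  A `Prop`, NEVER asserted.
[cite: Balaban1985Variational, (165) p.304, (144) p.300, (7) p.278; Balaban1985RegularSpaces, (1.3)–(1.6) p.77; Balaban1984PropagatorsII, (2.3) p.224] -/
def LocalLetters165TopStepCoreGB (Sup : (ν : Stage7Numerics) → (K : ℕ) → (ℕ → Set (Site (F.P K) 0)) → Set (Site (F.P K) 0)) (Adm : StepGuard F) (bd : BondDatum F) (Dat : TopData F N)
    (Ex0 : PlaqRange0 F) (B₃ C θ Q a₀ a₁ : ℝ) : Prop :=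
  ∀ (ν : Stage7Numerics) (M : ℕ) (g : ℕ → ℝ) (K k : ℕ) (s : SeqOfRecord F ν M g K k), Sect2.SeqSeparated ν.M₁ s → 0 < ν.M₁ → Adm ν M g K k s → 1 ≤ k →
    ∀ (ε δ : ℕ → ℝ),
    (∀ n, n ≤ k → 0 < δ n ∧ δ n ≤ a₁) → (∀ n, n < k → δ n ≤ 2 * δ (n + 1)) → (∀ n, n < k → δ (n + 1) ≤ 2 * δ n) →
    (∀ n, n ≤ k → B₃ * δ n ≤ ε n ∧ ε n ≤ a₀) → (∀ n, n < k → ε n ≤ 2 * ε (n + 1)) → (∀ n, n < k → ε (n + 1) ≤ 2 * ε n) →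
    ∀ W : MSField (F.P K) (SU N), Dat K s.Ω (Sup ν K s.Ω) k δ W →
      ∀ U : GaugeField (F.P K) 0 (SU N),
        (∀ n, n ≤ k → PlaqSmallOn (Sect2.omegaPlaqsTop s.Ω (Sup ν K s.Ω) n) (ε n * (F.P K).eta n ^ 2) U) →
        (∀ n, n ≤ k → Sect2.CoDivSmallOn (Sect2.omegaBondsTop s.Ω (Sup ν K s.Ω) n) (ε n * (F.P K).eta n ^ 3) U) →
        AgreeOnB (bd K k s.Ω) (avgFamily (avOfRecord F N K) U) W →
        IsCritOnFibreB F N K (bd K k s.Ω) W U →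
        ∀ m, m ≤ k →
          (∀ p ∈ Sect2.omegaPlaqsTop s.Ω (Sup ν K s.Ω) m, p ∉ Ex0 K k s.Ω →
            ∃ (Y : Set (Site (F.P K) 0)) (i : ℕ), m ≤ i ∧ i ≤ k ∧ p ∈ plaqInside Y ∧
              Sect2.LocalGauge10On Y ((F.P K).eta i) (C * δ i + θ * ε i + Q * ε i ^ 2) U) ∧
          (∀ b ∈ Sect2.omegaBondsTop s.Ω (Sup ν K s.Ω) m, b ∉ Sect2.bondsDeep (s.Ω 1)ᶜ →
            ∃ (Y : Set (Site (F.P K) 0)) (i : ℕ), m ≤ i ∧ i ≤ k ∧ b ∈ Sect2.bondsDeep Y ∧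
              Sect2.LocalGauge10On Y ((F.P K).eta i) (C * δ i + θ * ε i + Q * ε i ^ 2) U)

variable {F N}

/-- ★ dag-n07-w4's `LocalLetters165TopStepCoreG` IS the instance `(genSetDatum F) (dataSmall7PTopOf F N) (printedPlaqs0Of F)`, definitionally. [cite: Balaban1985Variational, (165) p.304; Balaban1988Convergent, (2.10) p.256] -/
theorem localLetters165TopStepCoreG_iff_GB {Sup : (ν : Stage7Numerics) → (K : ℕ) → (ℕ → Set (Site (F.P K) 0)) → Set (Site (F.P K) 0)} {Adm : StepGuard F} {B₃ C θ Q a₀ a₁ : ℝ} :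
    LocalLetters165TopStepCoreG F N Sup Adm B₃ C θ Q a₀ a₁ ↔ LocalLetters165TopStepCoreGB F N Sup Adm (genSetDatum F) (dataSmall7PTopOf F N) (printedPlaqs0Of F) B₃ C θ Q a₀ a₁ :=
  Iff.rfl

/-- Antitone in the ceilings. [cite: Balaban1985Variational, (165)–(166) p.304 (bookkeeping)] -/
theorem LocalLetters165TopStepCoreGB.of_le {Sup : (ν : Stage7Numerics) → (K : ℕ) → (ℕ → Set (Site (F.P K) 0)) → Set (Site (F.P K) 0)} {Adm : StepGuard F} {bd : BondDatum F} {Dat : TopData F N} {Ex0 : PlaqRange0 F}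
    {B₃ C θ Q a₀ a₀' a₁ a₁' : ℝ} (h : LocalLetters165TopStepCoreGB F N Sup Adm bd Dat Ex0 B₃ C θ Q a₀ a₁) (ha₀ : a₀' ≤ a₀) (ha₁ : a₁' ≤ a₁) :
    LocalLetters165TopStepCoreGB F N Sup Adm bd Dat Ex0 B₃ C θ Q a₀' a₁' :=
  fun ν M g K k s hsep hM₁ hc hk ε δ hδ hcomp hcomp' hε hεcomp hεcomp' W h7 U h17 h19 hfib hcrit =>
    h ν M g K k s hsep hM₁ hc hk ε δ (fun n hn => ⟨(hδ n hn).1, (hδ n hn).2.trans ha₁⟩) hcomp hcomp'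
      (fun n hn => ⟨(hε n hn).1, (hε n hn).2.trans ha₀⟩) hεcomp hεcomp' W h7 U h17 h19 hfib hcrit

/-- Monotone in the guard: a stronger guard only weakens the token. [cite: Balaban1985Variational, (144) p.300 (bookkeeping)] -/
theorem LocalLetters165TopStepCoreGB.of_imp {Sup : (ν : Stage7Numerics) → (K : ℕ) → (ℕ → Set (Site (F.P K) 0)) → Set (Site (F.P K) 0)} {Adm Adm' : StepGuard F} {bd : BondDatum F} {Dat : TopData F N}
    {Ex0 : PlaqRange0 F} {B₃ C θ Q a₀ a₁ : ℝ} (h : LocalLetters165TopStepCoreGB F N Sup Adm bd Dat Ex0 B₃ C θ Q a₀ a₁) (himp : ∀ ν M g K k s, Adm' ν M g K k s → Adm ν M g K k s) :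
    LocalLetters165TopStepCoreGB F N Sup Adm' bd Dat Ex0 B₃ C θ Q a₀ a₁ :=
  fun ν M g K k s hsep hM₁ hc' hk => h ν M g K k s hsep hM₁ (himp ν M g K k s hc') hk

/-- Antitone in the data predicate: a WEAKER data hypothesis `Dat′` (implied by `Dat`… conversely: the token at `Dat` serves every `Dat′ ⇒ Dat`). [cite: Balaban1985Variational, (7) p.278 (bookkeeping)] -/
theorem LocalLetters165TopStepCoreGB.of_imp_dat {Sup : (ν : Stage7Numerics) → (K : ℕ) → (ℕ → Set (Site (F.P K) 0)) → Set (Site (F.P K) 0)} {Adm : StepGuard F} {bd : BondDatum F} {Dat Dat' : TopData F N}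
    {Ex0 : PlaqRange0 F} {B₃ C θ Q a₀ a₁ : ℝ} (h : LocalLetters165TopStepCoreGB F N Sup Adm bd Dat Ex0 B₃ C θ Q a₀ a₁)
    (himp : ∀ (K : ℕ) (Ω : ℕ → Set (Site (F.P K) 0)) (Ω₀ : Set (Site (F.P K) 0)) (k : ℕ) (δ : ℕ → ℝ) (W : MSField (F.P K) (SU N)), Dat' K Ω Ω₀ k δ W → Dat K Ω Ω₀ k δ W) :
    LocalLetters165TopStepCoreGB F N Sup Adm bd Dat' Ex0 B₃ C θ Q a₀ a₁ :=
  fun ν M g K k s hsep hM₁ hc hk ε δ hδ hcomp hcomp' hε hεcomp hεcomp' W h7 =>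
    h ν M g K k s hsep hM₁ hc hk ε δ hδ hcomp hcomp' hε hεcomp hεcomp' W (himp _ _ _ _ _ _ h7)

/-- Monotone in the exclusion range: a SMALLER level-0 exclusion is a STRONGER token. [cite: Balaban1985Variational, (7) p.278, Sect. F p.304 (bookkeeping)] -/
theorem LocalLetters165TopStepCoreGB.of_subset_ex0 {Sup : (ν : Stage7Numerics) → (K : ℕ) → (ℕ → Set (Site (F.P K) 0)) → Set (Site (F.P K) 0)} {Adm : StepGuard F} {bd : BondDatum F} {Dat : TopData F N}
    {Ex0 Ex0' : PlaqRange0 F} {B₃ C θ Q a₀ a₁ : ℝ} (h : LocalLetters165TopStepCoreGB F N Sup Adm bd Dat Ex0' B₃ C θ Q a₀ a₁)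
    (hsub : ∀ (K k : ℕ) (Ω : ℕ → Set (Site (F.P K) 0)), Ex0' K k Ω ⊆ Ex0 K k Ω) : LocalLetters165TopStepCoreGB F N Sup Adm bd Dat Ex0 B₃ C θ Q a₀ a₁ := by
  intro ν M g K k s hsep hM₁ hc hk ε δ hδ hcomp hcomp' hε hεcomp hεcomp' W h7 U h17 h19 hfib hcrit m hm
  obtain ⟨hP, hB⟩ := h ν M g K k s hsep hM₁ hc hk ε δ hδ hcomp hcomp' hε hεcomp hεcomp' W h7 U h17 h19 hfib hcrit m hm
  exact ⟨fun p hp hpx => hP p hp fun h' => hpx (hsub K k s.Ω h'), hB⟩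

/-- ★★ **THE (165)-LETTERS OVER `(bd, Dat, Ex0)` CLOSE THE ONE-STEP IMPROVEMENT OVER THE SAME `(bd, Dat, Ex0)`** (dag-n07-w4's `halvingStepTopCoreG_of_localLetters165CoreG` with the rows
threaded): under `B₃ ≥ max{128C, 0}`, `θ ≤ 1∕512`, `Q ≥ 0`, `512·Q·a₀ ≤ 1`, `a₀ ≤ ½`, the token gives F0c's `HalvingStepTopCoreGB F N Sup Adm bd Dat Ex0 B₃ a₀ a₁`.
[cite: Balaban1985Variational, (165)–(168) p.304, (162)–(163) pp.303–304, Prop. 8 p.304; Balaban1985RegularSpaces, (1.7)–(1.9) p.77, (1.54) p.85] -/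
theorem halvingStepTopCoreGB_of_localLetters165CoreGB {Sup : (ν : Stage7Numerics) → (K : ℕ) → (ℕ → Set (Site (F.P K) 0)) → Set (Site (F.P K) 0)} {Adm : StepGuard F} {bd : BondDatum F}
    {Dat : TopData F N} {Ex0 : PlaqRange0 F} {B₃ C θ Q a₀ a₁ : ℝ} (h : LocalLetters165TopStepCoreGB F N Sup Adm bd Dat Ex0 B₃ C θ Q a₀ a₁) (hB₃ : 0 ≤ B₃) (hC : 128 * C ≤ B₃)
    (hθ' : 512 * θ ≤ 1) (hQ : 0 ≤ Q) (ha : 512 * Q * a₀ ≤ 1) (ha₀ : 2 * a₀ ≤ 1) : HalvingStepTopCoreGB F N Sup Adm bd Dat Ex0 B₃ a₀ a₁ := by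
  intro ν M g K k s hsep hM₁ hc hk ε δ hδ hcomp hcomp' hε hεcomp hεcomp' W h7 U h17 h19 hfib hcrit
  have htok := h ν M g K k s hsep hM₁ hc hk ε δ hδ hcomp hcomp' hε hεcomp hεcomp' W h7 U h17 h19 hfib hcrit
  have hδpos : ∀ n, n ≤ k → 0 < δ n := fun n hn => (hδ n hn).1
  have hbud : ∀ i, i ≤ k → 64 * (C * δ i + θ * ε i + Q * ε i ^ 2) ≤ max (B₃ * δ i) (ε i / 2) := fun i hi =>
    threshold167_of_budget165 hC hθ' hQ ha (hδ i hi).1 ((mul_nonneg hB₃ (hδ i hi).1.le).trans (hε i hi).1) (hε i hi).2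
  refine ⟨fun m hm p hp hpc => ?_, fun m hm b hb hbc => ?_⟩
  · obtain ⟨Y, i, hmi, hik, hpY, hg⟩ := (htok m hm).1 p hp hpc
    obtain ⟨hd, h32, -⟩ := thresholds168_b (T4Family.P_d F K) hB₃ (hδpos i hik) (hε i hik) ha₀ (hbud i hik)
    have hη := eta_pos_le_one_b (F.P K) i
    have h1 := (Sect2.regularTwo_of_localGauge10On hg hη.1 hη.2 hd).1 p hpY
    calc dist1 (GaugeField.plaqHol U p) < 32 * (C * δ i + θ * ε i + Q * ε i ^ 2) * (F.P K).eta i ^ 2 := h1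
      _ ≤ max (B₃ * δ i) (ε i / 2) * (F.P K).eta i ^ 2 := mul_le_mul_of_nonneg_right h32 (pow_nonneg hη.1.le 2)
      _ ≤ max (B₃ * δ m) (ε m / 2) * (F.P K).eta m ^ 2 := radius_descend (F.P K) hB₃ hδpos hcomp' hεcomp' one_le_two hmi hik
  · obtain ⟨Y, i, hmi, hik, hbY, hg⟩ := (htok m hm).2 b hb hbc
    obtain ⟨hd, -, h2⟩ := thresholds168_b (T4Family.P_d F K) hB₃ (hδpos i hik) (hε i hik) ha₀ (hbud i hik)
    have hη := eta_pos_le_one_b (F.P K) i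
    have h1 := (Sect2.regularTwo_of_localGauge10On hg hη.1 hη.2 hd).2 b hbY
    calc ‖Sect2.coDivSum U b.src b.dir‖ < 2 * (C * δ i + θ * ε i + Q * ε i ^ 2) * (F.P K).eta i ^ 3 := h1
      _ ≤ max (B₃ * δ i) (ε i / 2) * (F.P K).eta i ^ 3 := mul_le_mul_of_nonneg_right h2 (pow_nonneg hη.1.le 3)
      _ ≤ max (B₃ * δ m) (ε m / 2) * (F.P K).eta m ^ 3 := radius_descend (F.P K) hB₃ hδpos hcomp' hεcomp' (by norm_num) hmi hik

end Token165B

/-! ## §2  The split (R0′) token over `(bd, Dat, Ex0)` -/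

section TokenSplitB

variable (F : T4Family) (N : ℕ) [NeZero N]

/-- **[15] (165) IN A SPLIT LOCAL GAUGE, ROAD R0′ — GUARDED TOKEN OVER `(bd, Dat, Ex0)`**: dag-n07-w4's `LocalLettersSplitTopStepCoreG` with the three rows and the plaquette exclusion
parametrised.  Print-datum parametrisation of `LocalLettersSplitTopStepCoreG` (FLAG №16 ∕ LOCATE-HSEAM 5d3298b8d191f169); the (b)-instance stays landed and true on its own text
(`localLettersSplitTopStepCoreG_iff_GB`).  A `Prop`, NEVER asserted. [cite: Balaban1985Variational, (165) p.304, (152) p.301, (159) p.303, (144) p.300; Balaban1984PropagatorsII, (2.3) p.224] -/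
def LocalLettersSplitTopStepCoreGB (Sup : (ν : Stage7Numerics) → (K : ℕ) → (ℕ → Set (Site (F.P K) 0)) → Set (Site (F.P K) 0)) (Adm : StepGuard F) (bd : BondDatum F) (Dat : TopData F N)
    (Ex0 : PlaqRange0 F) (B₃ C θ Q κ a₀ a₁ : ℝ) : Prop :=
  ∀ (ν : Stage7Numerics) (M : ℕ) (g : ℕ → ℝ) (K k : ℕ) (s : SeqOfRecord F ν M g K k), Sect2.SeqSeparated ν.M₁ s → 0 < ν.M₁ → Adm ν M g K k s → 1 ≤ k →
    ∀ (ε δ : ℕ → ℝ),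
    (∀ n, n ≤ k → 0 < δ n ∧ δ n ≤ a₁) → (∀ n, n < k → δ n ≤ 2 * δ (n + 1)) → (∀ n, n < k → δ (n + 1) ≤ 2 * δ n) →
    (∀ n, n ≤ k → B₃ * δ n ≤ ε n ∧ ε n ≤ a₀) → (∀ n, n < k → ε n ≤ 2 * ε (n + 1)) → (∀ n, n < k → ε (n + 1) ≤ 2 * ε n) →
    ∀ W : MSField (F.P K) (SU N), Dat K s.Ω (Sup ν K s.Ω) k δ W →
      ∀ U : GaugeField (F.P K) 0 (SU N),
        (∀ n, n ≤ k → PlaqSmallOn (Sect2.omegaPlaqsTop s.Ω (Sup ν K s.Ω) n) (ε n * (F.P K).eta n ^ 2) U) →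
        (∀ n, n ≤ k → Sect2.CoDivSmallOn (Sect2.omegaBondsTop s.Ω (Sup ν K s.Ω) n) (ε n * (F.P K).eta n ^ 3) U) →
        AgreeOnB (bd K k s.Ω) (avgFamily (avOfRecord F N K) U) W →
        IsCritOnFibreB F N K (bd K k s.Ω) W U →
        ∀ m, m ≤ k →
          (∀ p ∈ Sect2.omegaPlaqsTop s.Ω (Sup ν K s.Ω) m, p ∉ Ex0 K k s.Ω →
            ∃ (Y : Set (Site (F.P K) 0)) (i : ℕ), m ≤ i ∧ i ≤ k ∧ p ∈ plaqInside Y ∧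
              LocalGaugeSplitOn Y ((F.P K).eta i) (κ * ε i) (C * δ i + θ * ε i + Q * ε i ^ 2) U) ∧
          (∀ b ∈ Sect2.omegaBondsTop s.Ω (Sup ν K s.Ω) m, b ∉ Sect2.bondsDeep (s.Ω 1)ᶜ →
            ∃ (Y : Set (Site (F.P K) 0)) (i : ℕ), m ≤ i ∧ i ≤ k ∧ b ∈ Sect2.bondsDeep Y ∧
              LocalGaugeSplitOn Y ((F.P K).eta i) (κ * ε i) (C * δ i + θ * ε i + Q * ε i ^ 2) U)

variable {F N}

/-- ★ dag-n07-w4's `LocalLettersSplitTopStepCoreG` IS the instance `(genSetDatum F) (dataSmall7PTopOf F N) (printedPlaqs0Of F)`, definitionally. [cite: Balaban1985Variational, (165) p.304; Balaban1988Convergent, (2.10) p.256] -/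
theorem localLettersSplitTopStepCoreG_iff_GB {Sup : (ν : Stage7Numerics) → (K : ℕ) → (ℕ → Set (Site (F.P K) 0)) → Set (Site (F.P K) 0)} {Adm : StepGuard F} {B₃ C θ Q κ a₀ a₁ : ℝ} :
    LocalLettersSplitTopStepCoreG F N Sup Adm B₃ C θ Q κ a₀ a₁ ↔
      LocalLettersSplitTopStepCoreGB F N Sup Adm (genSetDatum F) (dataSmall7PTopOf F N) (printedPlaqs0Of F) B₃ C θ Q κ a₀ a₁ :=
  Iff.rfl

/-- Antitone in the ceilings. [cite: Balaban1985Variational, (165)–(166) p.304 (bookkeeping)] -/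
theorem LocalLettersSplitTopStepCoreGB.of_le {Sup : (ν : Stage7Numerics) → (K : ℕ) → (ℕ → Set (Site (F.P K) 0)) → Set (Site (F.P K) 0)} {Adm : StepGuard F} {bd : BondDatum F} {Dat : TopData F N} {Ex0 : PlaqRange0 F}
    {B₃ C θ Q κ a₀ a₀' a₁ a₁' : ℝ} (h : LocalLettersSplitTopStepCoreGB F N Sup Adm bd Dat Ex0 B₃ C θ Q κ a₀ a₁) (ha₀ : a₀' ≤ a₀) (ha₁ : a₁' ≤ a₁) :
    LocalLettersSplitTopStepCoreGB F N Sup Adm bd Dat Ex0 B₃ C θ Q κ a₀' a₁' :=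
  fun ν M g K k s hsep hM₁ hc hk ε δ hδ hcomp hcomp' hε hεcomp hεcomp' W h7 U h17 h19 hfib hcrit =>
    h ν M g K k s hsep hM₁ hc hk ε δ (fun n hn => ⟨(hδ n hn).1, (hδ n hn).2.trans ha₁⟩) hcomp hcomp'
      (fun n hn => ⟨(hε n hn).1, (hε n hn).2.trans ha₀⟩) hεcomp hεcomp' W h7 U h17 h19 hfib hcrit

/-- Monotone in the guard. [cite: Balaban1985Variational, (144) p.300 (bookkeeping)] -/
theorem LocalLettersSplitTopStepCoreGB.of_imp {Sup : (ν : Stage7Numerics) → (K : ℕ) → (ℕ → Set (Site (F.P K) 0)) → Set (Site (F.P K) 0)} {Adm Adm' : StepGuard F} {bd : BondDatum F} {Dat : TopData F N}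
    {Ex0 : PlaqRange0 F} {B₃ C θ Q κ a₀ a₁ : ℝ} (h : LocalLettersSplitTopStepCoreGB F N Sup Adm bd Dat Ex0 B₃ C θ Q κ a₀ a₁)
    (himp : ∀ ν M g K k s, Adm' ν M g K k s → Adm ν M g K k s) : LocalLettersSplitTopStepCoreGB F N Sup Adm' bd Dat Ex0 B₃ C θ Q κ a₀ a₁ :=
  fun ν M g K k s hsep hM₁ hc' hk => h ν M g K k s hsep hM₁ (himp ν M g K k s hc') hk

/-- Antitone in the data predicate. [cite: Balaban1985Variational, (7) p.278 (bookkeeping)] -/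
theorem LocalLettersSplitTopStepCoreGB.of_imp_dat {Sup : (ν : Stage7Numerics) → (K : ℕ) → (ℕ → Set (Site (F.P K) 0)) → Set (Site (F.P K) 0)} {Adm : StepGuard F} {bd : BondDatum F} {Dat Dat' : TopData F N}
    {Ex0 : PlaqRange0 F} {B₃ C θ Q κ a₀ a₁ : ℝ} (h : LocalLettersSplitTopStepCoreGB F N Sup Adm bd Dat Ex0 B₃ C θ Q κ a₀ a₁)
    (himp : ∀ (K : ℕ) (Ω : ℕ → Set (Site (F.P K) 0)) (Ω₀ : Set (Site (F.P K) 0)) (k : ℕ) (δ : ℕ → ℝ) (W : MSField (F.P K) (SU N)), Dat' K Ω Ω₀ k δ W → Dat K Ω Ω₀ k δ W) :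
    LocalLettersSplitTopStepCoreGB F N Sup Adm bd Dat' Ex0 B₃ C θ Q κ a₀ a₁ :=
  fun ν M g K k s hsep hM₁ hc hk ε δ hδ hcomp hcomp' hε hεcomp hεcomp' W h7 =>
    h ν M g K k s hsep hM₁ hc hk ε δ hδ hcomp hcomp' hε hεcomp hεcomp' W (himp _ _ _ _ _ _ h7)

/-- Monotone in the exclusion range. [cite: Balaban1985Variational, (7) p.278, Sect. F p.304 (bookkeeping)] -/
theorem LocalLettersSplitTopStepCoreGB.of_subset_ex0 {Sup : (ν : Stage7Numerics) → (K : ℕ) → (ℕ → Set (Site (F.P K) 0)) → Set (Site (F.P K) 0)} {Adm : StepGuard F} {bd : BondDatum F} {Dat : TopData F N}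
    {Ex0 Ex0' : PlaqRange0 F} {B₃ C θ Q κ a₀ a₁ : ℝ} (h : LocalLettersSplitTopStepCoreGB F N Sup Adm bd Dat Ex0' B₃ C θ Q κ a₀ a₁)
    (hsub : ∀ (K k : ℕ) (Ω : ℕ → Set (Site (F.P K) 0)), Ex0' K k Ω ⊆ Ex0 K k Ω) : LocalLettersSplitTopStepCoreGB F N Sup Adm bd Dat Ex0 B₃ C θ Q κ a₀ a₁ := by
  intro ν M g K k s hsep hM₁ hc hk ε δ hδ hcomp hcomp' hε hεcomp hεcomp' W h7 U h17 h19 hfib hcrit m hm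
  obtain ⟨hP, hB⟩ := h ν M g K k s hsep hM₁ hc hk ε δ hδ hcomp hcomp' hε hεcomp hεcomp' W h7 U h17 h19 hfib hcrit m hm
  exact ⟨fun p hp hpx => hP p hp fun h' => hpx (hsub K k s.Ω h'), hB⟩

/-- ★★ **THE SPLIT TOKEN OVER `(bd, Dat, Ex0)` CLOSES THE ONE-STEP IMPROVEMENT OVER THE SAME `(bd, Dat, Ex0)`, ROAD R0′** (dag-n07-w4's `halvingStepTopCoreG_of_localLettersSplitCoreG`
with the rows threaded): under `B₃ ≥ max{4C, 0}`, `θ ≤ 1∕16`, `Q, κ ≥ 0`, `(16Q + 1024κ²)·a₀ ≤ 1`, `32κ·a₀ ≤ 1`, the token gives `HalvingStepTopCoreGB F N Sup Adm bd Dat Ex0 B₃ a₀ a₁`.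
[cite: Balaban1985Variational, (165)–(168) p.304, (162)–(163) pp.303–304, Prop. 8 p.304; Balaban1985RegularSpaces, (1.7)–(1.9) p.77, (1.54) p.85] -/
theorem halvingStepTopCoreGB_of_localLettersSplitCoreGB {Sup : (ν : Stage7Numerics) → (K : ℕ) → (ℕ → Set (Site (F.P K) 0)) → Set (Site (F.P K) 0)} {Adm : StepGuard F} {bd : BondDatum F}
    {Dat : TopData F N} {Ex0 : PlaqRange0 F} {B₃ C θ Q κ a₀ a₁ : ℝ} (h : LocalLettersSplitTopStepCoreGB F N Sup Adm bd Dat Ex0 B₃ C θ Q κ a₀ a₁) (hB₃ : 0 ≤ B₃)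
    (hC : 4 * C ≤ B₃) (hθ : 16 * θ ≤ 1) (hQ : 0 ≤ Q) (hκ : 0 ≤ κ) (ha : (16 * Q + 1024 * κ ^ 2) * a₀ ≤ 1) (hκa : 32 * κ * a₀ ≤ 1) :
    HalvingStepTopCoreGB F N Sup Adm bd Dat Ex0 B₃ a₀ a₁ := by
  intro ν M g K k s hsep hM₁ hc hk ε δ hδ hcomp hcomp' hε hεcomp hεcomp' W h7 U h17 h19 hfib hcrit
  have htok := h ν M g K k s hsep hM₁ hc hk ε δ hδ hcomp hcomp' hε hεcomp hεcomp' W h7 U h17 h19 hfib hcrit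
  have hδpos : ∀ n, n ≤ k → 0 < δ n := fun n hn => (hδ n hn).1
  have hε0 : ∀ n, n ≤ k → 0 ≤ ε n := fun n hn => (mul_nonneg hB₃ (hδpos n hn).le).trans (hε n hn).1
  have h32 : ∀ i, i ≤ k → 32 * (κ * ε i) ≤ 1 := fun i hi => by
    calc 32 * (κ * ε i) = 32 * κ * ε i := by ring
      _ ≤ 32 * κ * a₀ := mul_le_mul_of_nonneg_left (hε i hi).2 (by positivity)
      _ ≤ 1 := hκa
  have hd : ((F.P K).d : ℝ) = 4 := by exact_mod_cast T4Family.P_d F K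
  refine ⟨fun m hm p hp hpc => ?_, fun m hm b hb hbc => ?_⟩
  · obtain ⟨Y, i, hmi, hik, hpY, hg⟩ := (htok m hm).1 p hp hpc
    have hη := eta_pos_le_one_b (F.P K) i
    have h1 := (regularTwo_of_localGaugeSplitOn hg hη.1 hη.2 (h32 i hik)).1 p hpY
    have hbud := thresholdSplit_plaq hC hθ hQ ha (hδpos i hik) (hε0 i hik) (hε i hik).2
    calc dist1 (GaugeField.plaqHol U p) < (2 * (C * δ i + θ * ε i + Q * ε i ^ 2) + 24 * (κ * ε i) ^ 2) * (F.P K).eta i ^ 2 := h1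
      _ ≤ max (B₃ * δ i) (ε i / 2) * (F.P K).eta i ^ 2 := mul_le_mul_of_nonneg_right hbud (pow_nonneg hη.1.le 2)
      _ ≤ max (B₃ * δ m) (ε m / 2) * (F.P K).eta m ^ 2 := radius_descend (F.P K) hB₃ hδpos hcomp' hεcomp' one_le_two hmi hik
  · obtain ⟨Y, i, hmi, hik, hbY, hg⟩ := (htok m hm).2 b hb hbc
    have hη := eta_pos_le_one_b (F.P K) i
    have h1 := (regularTwo_of_localGaugeSplitOn hg hη.1 hη.2 (h32 i hik)).2 b hbY
    have hbud := thresholdSplit_bond hB₃ hC hθ hQ ha (hδpos i hik) (hε0 i hik) (hε i hik).2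
    rw [hd] at h1
    calc ‖Sect2.coDivSum U b.src b.dir‖ < (C * δ i + θ * ε i + Q * ε i ^ 2 + 32 * 4 * (κ * ε i) ^ 2) * (F.P K).eta i ^ 3 := h1
      _ ≤ max (B₃ * δ i) (ε i / 2) * (F.P K).eta i ^ 3 := mul_le_mul_of_nonneg_right hbud (pow_nonneg hη.1.le 3)
      _ ≤ max (B₃ * δ m) (ε m / 2) * (F.P K).eta m ^ 3 := radius_descend (F.P K) hB₃ hδpos hcomp' hεcomp' (by norm_num) hmi hik

end TokenSplitB

end Summit.QuantumFields.YangMills.BalabanUVNodes.N07LocalLettersCoreGuardedB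

end
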